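import Summits.BirchSwinnertonDyer.BirchSwinnertonDyer.Theorems.ManinLocalTwoThreeManinPrimeToAdditiveFiveLeCornersOfStrongIsUnstarred
import Summits.BirchSwinnertonDyer.BirchSwinnertonDyer.Theorems.ManinLocalTwoThreeManinPrimeToAdditiveFiveLeLedgerByNameOfKato
import Summits.BirchSwinnertonDyer.BirchSwinnertonDyer.Theorems.ManinLocalTwoThreeManinPrimeToAdditiveFiveLeRED13OfTwistedLatticeItems
import HarnessLib

/-!
# Route `ManinLocalTwoThree`, residual crux C5 `ManinPrimeToAdditiveFiveLe`
# (stmt-BirchSwinnertonDyer-22969), line `upper_anchor` (skeleton of record v12 bd42322545d00406):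
# **core RED(57) WITHOUT the ♯-cuts, directly from route `TwistFamilyManinDescent`'s three items —
# Cremona's table leaves the single-book ledger**

Extra width seat bsd-line-ml23-c5-p1-w4 (gen 2), piece ρ, part 1/2.

Since gen 2 the line carries the `W[p]`-reducible residual at `p ∈ {5, 7}` in the SHARP form RED(57♯) = RED(57) ∧
`N > 5·10⁵` ∧ `p ∣ deg φ` ∧ «no `Iₙ*` fibre» (p612504), and recovers RED(57) from it by
`coreRED57_of_cns_cremona_of_coreRED57sharp`, which spends Česnavičius–Neururer–Saha Thm. 1.2 on `p ∤ deg φ` and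
Cremona's table `cremona_abs_maninConstant_eq_one_of_level_le_500000` on `N ≤ 5·10⁵`. After the lead's gen-6 fold and
the width seat's ψ (p633129, p633601) every input of RED(57♯) is a BY-NAME item of route `TwistFamilyManinDescent` —
K15b `SupersingularUnstarredStrongManinUnit` (stmt-27071), `OrdinaryCornerManinResidual` (stmt-27552), K15a
`SupersingularStrongIsUnstarred` (stmt-27072) — and NONE of those items carries a level bound, a degree clause or a
Kodaira clause. So the ♯-cuts are scaffolding: this file proves the UNCUT core RED(57) (hypothesis `h57` of
`reducibleTwistMinimal_of_edixhoven_cns_of_cores`, p608852, VERBATIM) directly from the three items, by one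
Ogg–Tate row dispatch on `ord_p Δ_min(W)`:

* Raynaud rows `(5; 4/8)`, `(7; 3/9)`: K15a makes the lattice-optimal `W` unstarred, then K15b gives `p ∤ c`;
* the corner `(5; 2/10)` (II / II*, `e = 6`): the lattice-optimal `χ₅`-partner `W₀` of `W` (ψ's
  `exists_optimalPartner_pStar_of_row_two_or_ten`, p633129) is on `(5; 4)` — then the an-cell's irreducibility-free
  transport `c(D) ∣ c(D₀)` (θ, `maninConstant_dvd_of_isIsogenous_twist_pStar_of_padicValInt_lt_six`, p617000) and K15b
  on `(W₀, D₀)` — or on `(5; 8)`, which K15a empties; uniform for II and II* (no flip / commute split, no degree);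
* every other row — `(5; 3/9)`, `(7; 2/4/8/10)`, and the `I₀*` / `Iₙ*` rows — is a row of stmt-27552 as displayed
  (the `Iₙ*` rows are vacuous there: `W ⊗ χ_{p*}` is additive by global twist-minimality,
  `quadraticTwist_pStar_additive_of_twistMinimal`, p627706).

No ČNS, no Cremona, no `N`-bound, no `p ∣ deg φ`, no Kodaira bookkeeping on `W` itself.

* §1 `coreRED57_of_twistFamilyItems` — **RED(57) (uncut) ⟸ K15b ∧ stmt-27552 ∧ K15a, BY NAME.**
* §2 `maninPrimeToAdditiveFiveLe_of_sixPrints_dokchitser_of_twistFamilyItems` — the width seat's single-book ledger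
  `maninPrimeToAdditiveFiveLe_of_sevenPrints_of_twistFamilyItems` (p633601 §4) with Cremona's table REMOVED:
  C5 BY NAME ⟸ SIX cite-only prints {Kato F″, ČNS Thm. 1.2, Edixhoven Thm. 3 (both halves), Mazur 1978 Thm. 1,
  Dokchitser–Dokchitser 2015 Thm. 5.1 (1)} ∧ 27071 ∧ 27552 ∧ 27072 ∧ C1 (25939) ∧ C2 (26929).

Part 2/2 (`…LedgerFourPrints.lean`) removes Cremona AND ČNS from the E-imc-9(13) book of record (prints 6 → 4) by the
`N`-free / degree-free RED(13) (the extra width seat w4 gen 0's generic `degreeUp_of_ordinaryRamifiedTwistLaw`, p627800,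
fed to the lead's p618203 argument) and a ČNS-free stub 2.

Why it matters (numbers, not adjectives): the removed fact's own docstring (`Literature/…/ManinConstantConductorLe300000.lean`)
records the primary-source caveat of Cremona's `manin.txt` — the optimal curve is undetermined in 64 249 isogeny classes
with `400000 < N ≤ 500000`; C5's cone of record no longer rests on it. HONEST STATUS: conditional results
(`--supports … --as helper`) on OPEN items 27071 / 27552 / 27072 (and C1 / C2 / E-imc-9(13) in the ledgers) and
cite-only prints; nothing here proves C5, any TFMD item, Manin's conjecture or BSD.

References: [EdixhovenManin1991] Thm. 3, Prop. 7, §4; [Stevens1989] (5.2), (5.4); [SilvermanATAEC1994] IV Table 4.1;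
[SilvermanAEC2009] VII.5.1, X.5.4; [CesnaviciusNeururerSaha2023] Thm. 1.2 and §1 (the Cremona citation);
[DokchitserDokchitser2015LocalInvariants] Thm. 5.1 (1); [Mazur1978] Thm. 1; [Kato2004Asterisque] Thm. 9.7.
-/

set_option autoImplicit false
-- the Theorems namespace of this sub repeats the summit name by design (D-0017 nested layout)
set_option linter.dupNamespace false

noncomputable section

open scoped Classical NumberField

namespace Summit.BirchSwinnertonDyer.BirchSwinnertonDyer.Theorems

open WeierstrassCurve IsDedekindDomain IsDedekindDomain.HeightOneSpectrum Rat.HeightOneSpectrum NumberField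
  Literature.NumberTheory.EllipticCurves Literature.NumberTheory.EllipticCurves.ModularForms
  Literature.NumberTheory.EllipticCurves.Rank1Residual
  Literature.NumberTheory.DiophantineGeometry
  Summit.BirchSwinnertonDyer.Rank1Residual
  Summit.BirchSwinnertonDyer.Rank1Residual.ManinAdditive
  Summit.BirchSwinnertonDyer.Rank1Residual.Additive

/-! ## §1 Core RED(57), uncut, from K15b ∧ stmt-27552 ∧ K15a -/

/-- **Core RED(57) (hypothesis `h57` of `reducibleTwistMinimal_of_edixhoven_cns_of_cores`, p608852, VERBATIM — no
`N > 5·10⁵`, no `p ∣ deg φ`, no Kodaira clause) ⟸ K15b `SupersingularUnstarredStrongManinUnit` (stmt-27071) ∧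
`OrdinaryCornerManinResidual` (stmt-27552) ∧ K15a `SupersingularStrongIsUnstarred` (stmt-27072), all BY NAME.**
For `W` globally minimal with a lattice-optimal conductor-level datum `D`, `p ∈ {5, 7}`, `p² ∣ N(W)`, globally
twist-minimal (odd and dyadic clauses), `W[p]` reducible: `p ∤ c(D)`. Proof: `W ⊗ χ_{p*}` is additive at `p`
(twist-minimality); dispatch on `ord_p Δ_min(W)` — Raynaud rows: K15a then K15b; corner `(5; 2/10)`: the
lattice-optimal `χ₅`-partner is on `(5; 4)` (transport `c(D) ∣ c(D₀)` + K15b) or `(5; 8)` (empty by K15a); all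
other rows: stmt-27552 verbatim. Conditional result on three OPEN items; closes nothing.
[cite: EdixhovenManin1991, Thm. 3 and Prop. 7] [cite: Stevens1989, Lemmas (5.2), (5.4)] [cite: SilvermanATAEC1994, IV Table 4.1] -/
theorem coreRED57_of_twistFamilyItems
    (hSS : Summit.BirchSwinnertonDyer.BirchSwinnertonDyer.Theses.TwistFamilyManinDescent.SupersingularUnstarredStrongManinUnit)
    (hOrd : Summit.BirchSwinnertonDyer.BirchSwinnertonDyer.Theses.TwistFamilyManinDescent.OrdinaryCornerManinResidual)
    (hSU : Summit.BirchSwinnertonDyer.BirchSwinnertonDyer.Theses.TwistFamilyManinDescent.SupersingularStrongIsUnstarred) :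
    mazur_not_dvd_maninConstant_of_odd → abbesUllmo_not_dvd_maninConstant_of_not_dvd_level →
    cesnavicius_not_two_dvd_maninConstant_of_two_dvd_level → exists_isNewformOf →
    ∀ (W : WeierstrassCurve ℚ) [W.IsElliptic] [W.IsGloballyMinimal] [NeZero (W.conductorNorm ℤ)]
      (D : ModularParametrizationData W (W.conductorNorm ℤ)),
      IsLatticeOptimal D → ∀ p : ℕ, p.Prime → (p = 5 ∨ p = 7) → p ^ 2 ∣ W.conductorNorm ℤ →
      ¬ (∃ (W' : WeierstrassCurve ℚ) (q : ℕ), W'.IsElliptic ∧ W'.IsGloballyMinimal ∧ q.Prime ∧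
          q ≠ 2 ∧ q ^ 2 ∣ W.conductorNorm ℤ ∧
          IsIsogenous W (W'.quadraticTwist (((-1 : ℤ) ^ (q / 2) * q : ℤ) : ℚ)) ∧
          ¬ q ^ 2 ∣ W'.conductorNorm ℤ) →
      ¬ (∃ (W' : WeierstrassCurve ℚ) (d : ℤ), W'.IsElliptic ∧ W'.IsGloballyMinimal ∧
          (d = -1 ∨ d = 2 ∨ d = -2) ∧ 2 ^ 2 ∣ W.conductorNorm ℤ ∧
          IsIsogenous W (W'.quadraticTwist (d : ℚ)) ∧ ¬ 2 ^ 2 ∣ W'.conductorNorm ℤ) →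
      ¬ W.HasIrreducibleModPGaloisRep p →
      ¬ (p : ℤ) ∣ D.maninConstant := by
  intro hM hAU hC hnf W _ _ _ D hD p hp h57 hpN hodd _hdy hred
  haveI hpF : Fact p.Prime := ⟨hp⟩
  have h5 : 5 ≤ p := by rcases h57 with rfl | rfl <;> norm_num
  have hp2 : p ≠ 2 := by omega
  have hadd : Addv W p := not_good_and_not_mult_of_sq_dvd_conductorNorm W hpN
  -- `W ⊗ χ_{p*}` is additive at `p` (global twist-minimality at the odd prime `p`)
  have htw := quadraticTwist_pStar_additive_of_twistMinimal W hp hp2 hpN hodd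
  rcases h57 with rfl | rfl
  · -- `p = 5`
    by_cases hR : padicValInt 5 W.minimalDiscriminantInt ∈ ({4, 8} : Finset ℕ)
    · -- Raynaud rows `(5; 4/8)`: K15a ⇒ unstarred (`ord₅ Δ_min = 4`) ⇒ K15b
      have hlt := hSU W D 5 hp (Or.inl ⟨rfl, hR⟩) hpN hred htw hD
      have h4 : padicValInt 5 W.minimalDiscriminantInt = 4 := by
        simp only [Finset.mem_insert, Finset.mem_singleton] at hR
        omega
      exact hSS hM hAU hC hnf W D 5 hp (Or.inl ⟨rfl, h4⟩) hpN hred htw hD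
    · by_cases hK : padicValInt 5 W.minimalDiscriminantInt ∈ ({2, 10} : Finset ℕ)
      · -- the corner `(5; 2/10)` (II / II*): carried to the lattice-optimal `χ₅`-partner `W₀` on `(5; 4/8)`
        have hvW : padicValInt 5 W.minimalDiscriminantInt = 2 ∨ padicValInt 5 W.minimalDiscriminantInt = 10 := by
          simpa only [Finset.mem_insert, Finset.mem_singleton] using hK
        have hj : 0 ≤ padicValRat 5 W.j :=
          padicValRat_j_nonneg_of_addv_of_twist_pStar_not_semistable W 5 hp2 hadd htw
        obtain ⟨W₀, hE₀, hM₀, hne₀, D₀, hD₀, -, htw', hpN₀, hNN, hred₀, hodd₀, hv₀⟩ :=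
          exists_optimalPartner_pStar_of_row_two_or_ten hnf h5 W hpN hodd hred hj hvW
        haveI := hE₀
        haveI := hM₀
        haveI := hne₀
        have htw₀ := quadraticTwist_pStar_additive_of_twistMinimal W₀ hp hp2 hpN₀ hodd₀
        rcases hv₀ with hv₀ | hv₀
        · -- partner on `(5; 4)` (IV): `c(D) ∣ c(D₀)` (θ-transport, p617000) and K15b on `(W₀, D₀)`
          have hdvd := maninConstant_dvd_of_isIsogenous_twist_pStar_of_padicValInt_lt_six hp2 W₀ W D₀ D hD hpN₀
            hNN.symm htw' (by omega)
          have h₀ := hSS hM hAU hC hnf W₀ D₀ 5 hp (Or.inl ⟨rfl, hv₀⟩) hpN₀ hred₀ htw₀ hD₀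
          exact fun h5c ↦ h₀ (h5c.trans hdvd)
        · -- partner on `(5; 8)` (IV*): impossible, K15a makes a lattice-optimal curve there unstarred
          have hlt := hSU W₀ D₀ 5 hp (Or.inl ⟨rfl, by simp [hv₀]⟩) hpN₀ hred₀ htw₀ hD₀
          omega
      · -- every other row is a row of `OrdinaryCornerManinResidual` (stmt-27552)
        refine hOrd hM hAU hC hnf W D 5 hp (Or.inl rfl) ?_ ?_ hpN hred htw hD
        · rintro (⟨-, h⟩ | ⟨h, -⟩)
          · exact hR h
          · norm_num at h
        · rintro ⟨-, h⟩
          exact hK h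
  · -- `p = 7`
    by_cases hR : padicValInt 7 W.minimalDiscriminantInt ∈ ({3, 9} : Finset ℕ)
    · -- Raynaud rows `(7; 3/9)`: K15a ⇒ unstarred (`ord₇ Δ_min = 3`) ⇒ K15b
      have hlt := hSU W D 7 hp (Or.inr ⟨rfl, hR⟩) hpN hred htw hD
      have h3 : padicValInt 7 W.minimalDiscriminantInt = 3 := by
        simp only [Finset.mem_insert, Finset.mem_singleton] at hR
        omega
      exact hSS hM hAU hC hnf W D 7 hp (Or.inr ⟨rfl, h3⟩) hpN hred htw hD
    · refine hOrd hM hAU hC hnf W D 7 hp (Or.inr rfl) ?_ ?_ hpN hred htw hD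
      · rintro (⟨h, -⟩ | ⟨-, h⟩)
        · norm_num at h
        · exact hR h
      · rintro ⟨h, -⟩
        norm_num at h

/-! ## §2 The single-book ledger without Cremona's table -/

/-- **Crux C5 `ManinLocalTwoThree.ManinPrimeToAdditiveFiveLe` BY NAME ⟸ SIX cite-only prints {Kato F″, ČNS Thm. 1.2,
Edixhoven 1991 Thm. 3 (Kodaira half, ordinarity half), Mazur 1978 Thm. 1, Dokchitser–Dokchitser 2015 Thm. 5.1 (1)} ∧ K15b
(stmt-27071) ∧ `OrdinaryCornerManinResidual` (stmt-27552) ∧ K15a (stmt-27072) ∧ C1 `EisensteinOrdinaryTwistLatticeNotBottom`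
(stmt-25939) ∧ C2 `EisensteinOrdinaryStrongIsTop` (stmt-26929)** — the width seat's
`maninPrimeToAdditiveFiveLe_of_sevenPrints_of_twistFamilyItems` (p633601 §4) with Cremona's table
`cremona_abs_maninConstant_eq_one_of_level_le_500000` REMOVED: the reducible residual at `5, 7` is §1 (uncut), at
`p ≥ 11` it is Mazur's list + pub/bsd-wall's `coreRED13_of_notBottom_of_strongIsTop` (p621027), the irreducible locus is
`coreKP_of_kato` (modularity ∧ F″). Conditional result (`--supports`, helper); nothing here proves C5, any TFMD item,
Manin's conjecture or BSD. [cite: Kato2004Asterisque, Thm. 9.7] [cite: CesnaviciusNeururerSaha2023, Thm. 1.2]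
[cite: EdixhovenManin1991, Thm. 3] [cite: Mazur1978, Thm. 1] [cite: DokchitserDokchitser2015LocalInvariants, Thm. 5.1 (1)] -/
theorem maninPrimeToAdditiveFiveLe_of_sixPrints_dokchitser_of_twistFamilyItems
    (hK57 : kato_neron_isIntegral_twistedSymbolSum_of_additive_five_le)
    (hCNS : cesnaviciusNeururerSaha_padicVal_maninConstant_le_modularDegree)
    (hEdK : edixhoven_not_dvd_maninConstant_of_kodairaSymbol_ne)
    (hEdG : edixhoven_not_dvd_maninConstant_of_not_potentiallyGoodOrdinary)
    (hJ : mazur_j_mem_of_not_hasIrreducibleModPGaloisRep_of_eleven_le)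
    (hDD : dokchitser_padicValInt_minimalDiscriminantInt_eq_of_isogeny_of_potentiallyGoodOrdinary)
    (hK15b : Summit.BirchSwinnertonDyer.BirchSwinnertonDyer.Theses.TwistFamilyManinDescent.SupersingularUnstarredStrongManinUnit)
    (hOrd : Summit.BirchSwinnertonDyer.BirchSwinnertonDyer.Theses.TwistFamilyManinDescent.OrdinaryCornerManinResidual)
    (hK15a : Summit.BirchSwinnertonDyer.BirchSwinnertonDyer.Theses.TwistFamilyManinDescent.SupersingularStrongIsUnstarred)
    (hC1 : Summit.BirchSwinnertonDyer.BirchSwinnertonDyer.Theses.TwistFamilyManinDescent.EisensteinOrdinaryTwistLatticeNotBottom)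
    (hC2 : Summit.BirchSwinnertonDyer.BirchSwinnertonDyer.Theses.TwistFamilyManinDescent.EisensteinOrdinaryStrongIsTop) :
    Summit.BirchSwinnertonDyer.BirchSwinnertonDyer.Theses.ManinLocalTwoThree.ManinPrimeToAdditiveFiveLe := by
  have h57 := coreRED57_of_twistFamilyItems hK15b hOrd hK15a
  have h11 := coreRED11_of_mazurJ_of_coreRED13 hJ (coreRED13_of_notBottom_of_strongIsTop hC1 hC2 hEdK hDD)
  intro hM hAU hC hnf
  exact maninLocalTwoThree_maninPrimeToAdditiveFiveLe_of_kato57_of_cores hK57 (coreKP_of_kato hnf hK57)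
    (reducibleTwistMinimal_of_edixhoven_cns_of_cores hEdK hEdG hCNS h57 h11) hM hAU hC hnf

end Summit.BirchSwinnertonDyer.BirchSwinnertonDyer.Theorems

end
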